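import Summits.HodgeConjecture.HodgeConjecture.Theses.GenericDivisibility
import Summits.HodgeConjecture.HodgeConjecture.Theorems.GenericDivisibilityHodgeClassesGenericallyDivisible
import Summits.HodgeConjecture.HodgeConjecture.Theorems.GenericDivisibilityGenericDivisibilityBoundedCruxAtOfSurjective
import Summits.HodgeConjecture.HodgeConjecture.Theorems.GenericDivisibilityHodgeClassesGenericallyDivisibleStubBockstein
import Literature.AlgebraicTopology.SingularHomology.GysinMapSupportSelfInjective
import Literature.AlgebraicTopology.SingularHomology.IntegralClassRingChange
import Literature.AlgebraicGeometry.HodgeTheory.ComplexOrientationDegreeFibre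
import Literature.AlgebraicGeometry.HodgeTheory.GysinFormalismPushforward
import Literature.AlgebraicGeometry.HodgeTheory.GysinKernel
import Literature.AlgebraicGeometry.HodgeTheory.HodgeTypeExteriorProduct
import Literature.AlgebraicGeometry.Motives.UnramifiedCohomology
import HarnessLib

/-!
# Route GenericDivisibility — crux C1 `HodgeClassesGenericallyDivisible` (stmt-HodgeConjecture-18466)
# DESCENDS along morphisms of finite degree `d`, at every modulus prime to `d`

`f : Y ⟶ X` is a `ℂ`-morphism of smooth projective `n`-folds, `F = f(ℂ)`, `H = H^k(–(ℂ); ℤ)`,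
`z| = z|_{(X∖Z)(ℂ)}`; "`z` is generically `m`-divisible" means `z| = m • y` off some proper
Zariski-closed `Z`. The landed `…BirationalDescent` / `…BirationalInvarianceUnconditional` make C1 a
birational invariant. Here the morphism may have any degree:

**If `F_* [Y(ℂ)] = d • [X(ℂ)]` modulo `m` and `f^* z` is generically `m`-divisible on `Y`, then
`d • z` is generically `m`-divisible on `X`** (`genericDivisibility_exists_nsmul_eq_restrict_smul_of_map`).
So for `m` prime to `d`, `z` itself is (`…_of_coprime`, Bézout), and **C1 at `Y` implies C1 at `X`
at every modulus prime to `d`** whenever `f` has a complex point with a finite fibre of `d` local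
homeomorphism points — e.g. `f` generically finite of degree `d`, over a point of its finite étale
locus (`hodgeClassesGenericallyDivisible_at_of_finite_fibre_of_coprime`). The primes dividing `d`
are exactly where a transfer argument must lose: `f_! f^* = d`.

## The argument (projection formula modulo `m`, in support form)

Reduce modulo `m`: `w̄ = (f^* z) ⊗ ℤ/m = F^*(z ⊗ ℤ/m)` dies on `(Y ∖ S)(ℂ)` (`(f^* z)| = m • y'`),
hence on `(Y ∖ f⁻¹ f S)(ℂ)`. The SUPPORT FORM of "Gysin maps commute with restriction to open
subsets" holds over the self-injective ring `ℤ/m` (the tree's `gysinMap_restrictCompl_eq_zero_zmod`,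
`Literature/AlgebraicTopology/SingularHomology/GysinMapSupportSelfInjective`: near-compact vanishing
by Čech–Poincaré duality, then Kronecker detection over `ℤ/m`), so `F_! w̄` dies on `(X ∖ f S)(ℂ)`
for the Gysin map of the `ℤ/m`-orientations `complexOrientationInt ⊗ ℤ/m`; and
`F_! w̄ = F_! F^* (z ⊗ ℤ/m) = d • (z ⊗ ℤ/m) = (d • z) ⊗ ℤ/m` (`gysinMap_map_of_hasDegree`). The image
`f S` is closed (`f` is proper) and proper (closed maps do not raise dimensions,
`le_coheight_of_mem_image`), and Bockstein (`stub_bockstein`) turns "`(d • z) ⊗ ℤ/m` dies off `f S`"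
into "`(d • z)| = m • y`".

## Main results

* `genericDivisibility_exists_nsmul_eq_restrict_smul_of_map` — the transfer modulo `m`, with the
  degree hypothesis `HasDegree (complexOrientationInt hY ⊗ ℤ/m) (complexOrientationInt hX ⊗ ℤ/m) F d`;
* `genericDivisibility_exists_nsmul_eq_restrict_of_smul_of_coprime` — Bézout: `d • z` generically
  `m`-divisible and `gcd(d, m) = 1` ⟹ `z` generically `m`-divisible;
* `genericDivisibility_exists_nsmul_eq_restrict_of_map_of_finite_fibre_of_coprime` — the transfer
  for `f` with a finite fibre of `d` local-homeomorphism points (the degree hypothesis discharged by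
  `hasDegree_toCoeff_complexOrientationInt_of_finite_fibre`), `m` prime to `d`;
* `hodgeClassesGenericallyDivisible_at_of_finite_fibre_of_coprime` — **C1 at `Y` ⟹ C1 at `X` at
  every `m` prime to `d`** (Hodge types pull back, `IsOfHodgeType.map_of_isSmoothProjective`).

References: [Fulton1998] §1.4, Lemma 19.1.2, §19.1; [FultonYoungTableaux1997] App. B §B.1 (5)–(7),
§B.2 Exercise 5; [VoisinHodgeI2002] §7.3.2 Remark 7.29; [HatcherAT2002] §2.2 Prop. 2.30, §3.1
Thm. 3.2, §3.3 Thm. 3.44, §3.E; [Lam1999] §15; [BlochOgus1974ENS] (3.8).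
-/

set_option linter.dupNamespace false

noncomputable section

namespace Summit.HodgeConjecture.HodgeConjecture.Theorems

open CategoryTheory AlgebraicGeometry
open Literature.AlgebraicGeometry.Motives Literature.AlgebraicGeometry.HodgeTheory
  Literature.AlgebraicTopology.SingularHomology

/-- Restriction `H^k(X(ℂ);R) → H^k((X∖Z)(ℂ);R)` (notation only). -/
local notation3 (prettyPrint := false) "ResR[" R ", " X ", " Z ", " k "]" =>
  singularCohomology.map R R
    (⟨Subtype.val, continuous_subtype_val⟩ : C(complexPointsCompl X Z, ComplexPoints X)) k

/-- Restriction `H^k(X(ℂ);ℤ) → H^k((X∖Z)(ℂ);ℤ)`, the very term of the route decls (notation only). -/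
local notation3 (prettyPrint := false) "Res[" X ", " Z ", " k "]" =>
  singularCohomology.map ℤ ℤ
    (⟨Subtype.val, continuous_subtype_val⟩ : C(complexPointsCompl X Z, ComplexPoints X)) k

variable {n : ℕ} {Y X : SchemeOver ℂ}

/-! ### The image of a proper Zariski-closed subset -/

/-- **The image of a proper Zariski-closed subset under a morphism of smooth projective varieties of
the same dimension is closed and proper** (`f` is proper, hence closed; closed maps do not raise the
dimension of points, `le_coheight_of_mem_image`, and on an irreducible variety a closed subset is
proper iff all its points have codimension `≥ 1`). [cite: Hartshorne1977, II Ex. 3.20 and Ex. 4.4] -/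
theorem genericDivisibility_image_isClosed_ne_univ (hY : IsSmoothProjective n Y)
    (hX : IsSmoothProjective n X) (f : Y ⟶ X) {S : Set Y.left} (hS : IsClosed S)
    (hSne : S ≠ Set.univ) : IsClosed (f.left.base '' S) ∧ f.left.base '' S ≠ Set.univ := by
  haveI : IsProper f.left := isProper_left_of_isSmoothProjective hY hX f
  haveI : IrreducibleSpace Y.left := by
    haveI := hY.geometricallyIrreducible
    exact AlgebraicGeometry.GeometricallyIrreducible.irreducibleSpace_of_subsingleton Y.hom
  haveI : IrreducibleSpace X.left := by
    haveI := hX.geometricallyIrreducible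
    exact AlgebraicGeometry.GeometricallyIrreducible.irreducibleSpace_of_subsingleton X.hom
  have hf : IsClosedMap f.left.base := f.left.isClosedMap
  have hT : IsClosed (f.left.base '' S) := hf _ hS
  refine ⟨hT, (forall_one_le_coheight_iff_ne_univ hT).1 fun x hx ↦ ?_⟩
  exact le_coheight_of_mem_image hY hX f hf (r := 1) (s := 1)
    ((forall_one_le_coheight_iff_ne_univ hS).2 hSne) (Nat.add_comm 1 n).le hx

/-! ### The transfer modulo `m` -/

/-- **Projection formula in support form, modulo `m`: if `F_* [Y(ℂ)] = d • [X(ℂ)]` (mod `m`) and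
`f^* z` is generically `m`-divisible on `Y`, then `d • z` is generically `m`-divisible on `X`.**
Here `f : Y ⟶ X` is a morphism of smooth projective `n`-folds, `F = f(ℂ)`, `z ∈ H^k(X(ℂ);ℤ)`,
`k + q = 2n`, `m ≥ 1`, and the degree is that of the `ℤ/m`-orientations `complexOrientationInt ⊗ ℤ/m`.
With `w̄ = F^*(z ⊗ ℤ/m)`: `w̄` dies off `f⁻¹ f S`, so `F_! w̄ = d • (z ⊗ ℤ/m)`
(`gysinMap_map_of_hasDegree`) dies off the proper closed `f S` (`gysinMap_restrictCompl_eq_zero_zmod`,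
the support form of Borel–Moore base change over the self-injective `ℤ/m`), and Bockstein.
[cite: FultonYoungTableaux1997, Appendix B §B.1 (5)–(7) and §B.2 Exercise 5] [cite: Fulton1998, Lemma 19.1.2]
[cite: HatcherAT2002, §3.E p. 303] -/
theorem genericDivisibility_exists_nsmul_eq_restrict_smul_of_map (hY : IsSmoothProjective n Y)
    (hX : IsSmoothProjective n X) (f : Y ⟶ X) {k q : ℕ} (h : k + q = 2 * n)
    (z : singularCohomology ℤ ℤ (ComplexPoints X) k) {m : ℕ} (hm : 1 ≤ m) (d : ℤ)
    (hdeg : letI := hY.chartedSpace; letI := hX.chartedSpace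
      haveI := ComplexPoints.t2Space_of_isSmoothProjective hY
      haveI := ComplexPoints.t2Space_of_isSmoothProjective hX
      HasDegree ((complexOrientationInt hY).toCoeff (ZMod m))
        ((complexOrientationInt hX).toCoeff (ZMod m)) (AlgPoints.mapContinuous (L := ℂ) f) d)
    (hdiv : ∃ S : Set Y.left, IsClosed S ∧ S ≠ Set.univ ∧
      ∃ y' : singularCohomology ℤ ℤ (complexPointsCompl Y S) k,
        m • y' = Res[Y, S, k] (singularCohomology.map ℤ ℤ (AlgPoints.mapContinuous (L := ℂ) f) k z)) :
    ∃ Z : Set X.left, IsClosed Z ∧ Z ≠ Set.univ ∧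
      ∃ y : singularCohomology ℤ ℤ (complexPointsCompl X Z) k, m • y = Res[X, Z, k] (d • z) := by
  letI := hY.chartedSpace
  letI := hX.chartedSpace
  haveI := ComplexPoints.compactSpace_of_isSmoothProjective hX
  haveI := ComplexPoints.compactSpace_of_isSmoothProjective hY
  haveI := ComplexPoints.t2Space_of_isSmoothProjective hX
  haveI := ComplexPoints.t2Space_of_isSmoothProjective hY
  haveI : NeZero m := ⟨by omega⟩
  set F : C(ComplexPoints Y, ComplexPoints X) := AlgPoints.mapContinuous (L := ℂ) f with hF
  set μY := (complexOrientationInt hY).toCoeff (ZMod m) with hμY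
  set μX := (complexOrientationInt hX).toCoeff (ZMod m) with hμX
  have hPD : μX.HasPoincareDuality := fun _ _ h' ↦ poincare_duality _ h'
  obtain ⟨S, hS, hSne, y', hy'⟩ := hdiv
  -- the proper closed image `T = f S` and its complex points `K`
  obtain ⟨hT, hTne⟩ := genericDivisibility_image_isClosed_ne_univ hY hX f hS hSne
  set T : Set X.left := f.left.base '' S with hTdef
  have hK : IsClosed {Q : ComplexPoints X | Q.pt ∈ T} := isClosed_setOf_pt_mem hT
  -- `w̄ = F^*(z ⊗ ℤ/m)` dies on `(Y ∖ S)(ℂ)`, hence on `(Y ∖ f⁻¹T)(ℂ) = Y(ℂ) ∖ F⁻¹K`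
  set zm := singularCohomology.ringChange (Int.castRingHom (ZMod m)) (ComplexPoints X) k z with hzm
  have hw0 : ResR[ZMod m, Y, S, k] (singularCohomology.map (ZMod m) (ZMod m) F k zm) = 0 := by
    rw [hzm, ← singularCohomology.ringChange_map, ← singularCohomology.ringChange_map, ← hy',
      AddMonoidHom.map_nsmul, ← Nat.cast_smul_eq_nsmul (ZMod m), ZMod.natCast_self, zero_smul]
  have hST : S ⊆ f.left.base ⁻¹' T := Set.subset_preimage_image _ S
  have hw : singularCohomology.map (ZMod m) (ZMod m)
      (⟨Subtype.val, continuous_subtype_val⟩ :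
        C(↥(F ⁻¹' {Q : ComplexPoints X | Q.pt ∈ T})ᶜ, ComplexPoints Y)) k
      (singularCohomology.map (ZMod m) (ZMod m) F k zm) = 0 := by
    have e := genericDivisibility_restrict_restrict (ZMod m) hST k
      (singularCohomology.map (ZMod m) (ZMod m) F k zm)
    rw [hw0, map_zero] at e
    exact e.symm
  -- support form of "Gysin commutes with restriction", modulo `m`
  have hG := gysinMap_restrictCompl_eq_zero_zmod m μY μX hPD F h h hK _ hw
  rw [gysinMap_map_of_hasDegree hPD hdeg h zm, hzm, ← AddMonoidHom.map_zsmul,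
    ← singularCohomology.ringChange_map] at hG
  -- Bockstein on `(X ∖ T)(ℂ)`
  obtain ⟨y, hy⟩ := stub_bockstein k m hm (Res[X, T, k] (d • z)) hG
  exact ⟨T, hT, hTne, y, hy.symm⟩

/-! ### Bézout -/

/-- **If `d • z` is generically `m`-divisible and `gcd(d, m) = 1` then `z` is generically
`m`-divisible** (on the same open): `d a = m q + 1`, so `z| = a • (d • z)| - m • (q • z|)`.
[cite: BlochOgus1974ENS, (3.8)] -/
theorem genericDivisibility_exists_nsmul_eq_restrict_of_smul_of_coprime {k : ℕ}
    (z : singularCohomology ℤ ℤ (ComplexPoints X) k) {m d : ℕ} (hdm : d.Coprime m)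
    (h : ∃ Z : Set X.left, IsClosed Z ∧ Z ≠ Set.univ ∧
      ∃ y : singularCohomology ℤ ℤ (complexPointsCompl X Z) k, m • y = Res[X, Z, k] ((d : ℤ) • z)) :
    ∃ Z : Set X.left, IsClosed Z ∧ Z ≠ Set.univ ∧
      ∃ y : singularCohomology ℤ ℤ (complexPointsCompl X Z) k, m • y = Res[X, Z, k] z := by
  obtain ⟨Z, hZ, hZne, y, hy⟩ := h
  set w := Res[X, Z, k] z with hw
  have hdw : (d : ℤ) • w = m • y := by rw [hy, map_zsmul]
  rcases Nat.lt_or_ge 1 m with hm | hm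
  · -- Bézout in `ℕ`: `d a = m q + 1`
    obtain ⟨a, -, ha⟩ := Nat.exists_mul_mod_eq_one_of_coprime hdm hm
    have hdm' := Nat.div_add_mod (d * a) m
    rw [ha] at hdm'
    refine ⟨Z, hZ, hZne, a • y - (d * a / m) • w, ?_⟩
    have h1 : (d * a) • w = m • (a • y) := by
      rw [mul_comm, mul_nsmul', ← natCast_zsmul w d, hdw, ← mul_nsmul', ← mul_nsmul', mul_comm]
    have h2 : (d * a) • w = m • ((d * a / m) • w) + w := by
      conv_lhs => rw [← hdm', add_nsmul, one_nsmul, mul_nsmul']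
    rw [nsmul_sub, ← h1, h2, add_sub_cancel_left]
  · interval_cases m
    · have hd1 : d = 1 := (Nat.coprime_zero_right d).1 hdm
      subst hd1
      refine ⟨Z, hZ, hZne, y, ?_⟩
      rw [hy, Nat.cast_one, one_zsmul]
    · exact ⟨Z, hZ, hZne, w, one_nsmul w⟩

/-! ### Finite fibres: the degree hypothesis discharged -/

/-- **The transfer for a morphism with a finite fibre of local-homeomorphism points, at a modulus
prime to the cardinality of the fibre.** Let `f : Y ⟶ X` be a morphism of smooth projective
`n`-folds and `b` a complex point of `X` whose fibre `F⁻¹(b) = {v i}ᵢ` is finite with `F = f(ℂ)` a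
local homeomorphism at each `v i` (e.g. `b` in the finite étale locus of a generically finite `f`),
so that `F_* [Y(ℂ)] = (#ι) • [X(ℂ)]` for the complex orientations with any coefficients
(`hasDegree_toCoeff_complexOrientationInt_of_finite_fibre`, Fulton Lemma 19.1.2). If `f^* z` is
generically `m`-divisible on `Y` and `m` is prime to `#ι`, then `z` is generically `m`-divisible
on `X`. [cite: Fulton1998, Lemma 19.1.2 and §1.4] [cite: FultonYoungTableaux1997, Appendix B §B.2 Exercise 5]
[cite: HatcherAT2002, §2.2 Prop. 2.30 and §3.E p. 303] -/
theorem genericDivisibility_exists_nsmul_eq_restrict_of_map_of_finite_fibre_of_coprime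
    (hY : IsSmoothProjective n Y) (hX : IsSmoothProjective n X) (f : Y ⟶ X) {ι : Type}
    [Fintype ι] {v : ι → ComplexPoints Y} (hv : Function.Injective v) {b : ComplexPoints X}
    (hfibre : (AlgPoints.map f) ⁻¹' {b} = Set.range v)
    (hloc : ∀ i, ∃ e : OpenPartialHomeomorph (ComplexPoints Y) (ComplexPoints X),
      v i ∈ e.source ∧ (e : ComplexPoints Y → ComplexPoints X) = AlgPoints.map f)
    {k q : ℕ} (h : k + q = 2 * n) (z : singularCohomology ℤ ℤ (ComplexPoints X) k) {m : ℕ}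
    (hm : 1 ≤ m) (hcop : (Fintype.card ι).Coprime m)
    (hdiv : ∃ S : Set Y.left, IsClosed S ∧ S ≠ Set.univ ∧
      ∃ y' : singularCohomology ℤ ℤ (complexPointsCompl Y S) k,
        m • y' = Res[Y, S, k] (singularCohomology.map ℤ ℤ (AlgPoints.mapContinuous (L := ℂ) f) k z)) :
    ∃ Z : Set X.left, IsClosed Z ∧ Z ≠ Set.univ ∧
      ∃ y : singularCohomology ℤ ℤ (complexPointsCompl X Z) k, m • y = Res[X, Z, k] z :=
  genericDivisibility_exists_nsmul_eq_restrict_of_smul_of_coprime z hcop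
    (genericDivisibility_exists_nsmul_eq_restrict_smul_of_map hY hX f h z hm (Fintype.card ι)
      (hasDegree_toCoeff_complexOrientationInt_of_finite_fibre (ZMod m) hY hX f hv hfibre hloc) hdiv)

/-- **C1 descends along morphisms with a finite fibre of `d` local-homeomorphism points, at every
modulus prime to `d`.** Let `f : Y ⟶ X` be a morphism of smooth projective `2p`-folds with a
complex point `b` of `X` over which `F = f(ℂ)` has the finite fibre `{v i}ᵢ` of local-homeomorphism
points, and suppose C1 holds at `Y`. Then every integral class `z` on `X` with `z ⊗ ℂ` of type
`(p,p)` is generically `m`-divisible for every `m ≥ 1` prime to `#ι`: `f^* z` is of type `(p,p)`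
(`IsOfHodgeType.map_of_isSmoothProjective`), C1 at `Y` applies to it, and the transfer above.
[cite: VoisinHodgeI2002, §7.3.2 Remark 7.29] [cite: Fulton1998, Lemma 19.1.2]
[cite: FultonYoungTableaux1997, Appendix B §B.2 Exercise 5] -/
theorem hodgeClassesGenericallyDivisible_at_of_finite_fibre_of_coprime {p : ℕ}
    (hY : IsSmoothProjective (2 * p) Y) (hX : IsSmoothProjective (2 * p) X) (f : Y ⟶ X) {ι : Type}
    [Fintype ι] {v : ι → ComplexPoints Y} (hv : Function.Injective v) {b : ComplexPoints X}
    (hfibre : (AlgPoints.map f) ⁻¹' {b} = Set.range v)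
    (hloc : ∀ i, ∃ e : OpenPartialHomeomorph (ComplexPoints Y) (ComplexPoints X),
      v i ∈ e.source ∧ (e : ComplexPoints Y → ComplexPoints X) = AlgPoints.map f)
    (hC : ∀ w : singularCohomology ℤ ℤ (ComplexPoints Y) (2 * p),
      IsOfHodgeType (2 * p) Y (2 * p) p p
          (singularCohomology.ringChange (Int.castRingHom ℂ) (ComplexPoints Y) (2 * p) w) →
        ∀ m : ℕ, 1 ≤ m → ∃ Z : Set Y.left, IsClosed Z ∧ Z ≠ Set.univ ∧
          ∃ y : singularCohomology ℤ ℤ (complexPointsCompl Y Z) (2 * p), m • y = Res[Y, Z, 2 * p] w)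
    (z : singularCohomology ℤ ℤ (ComplexPoints X) (2 * p))
    (hz : IsOfHodgeType (2 * p) X (2 * p) p p
      (singularCohomology.ringChange (Int.castRingHom ℂ) (ComplexPoints X) (2 * p) z))
    {m : ℕ} (hm : 1 ≤ m) (hcop : (Fintype.card ι).Coprime m) :
    ∃ Z : Set X.left, IsClosed Z ∧ Z ≠ Set.univ ∧
      ∃ y : singularCohomology ℤ ℤ (complexPointsCompl X Z) (2 * p), m • y = Res[X, Z, 2 * p] z := by
  have h2 : 2 * p + 2 * p = 2 * (2 * p) := by ring
  refine genericDivisibility_exists_nsmul_eq_restrict_of_map_of_finite_fibre_of_coprime hY hX f hv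
    hfibre hloc h2 z hm hcop (hC _ ?_ m hm)
  rw [singularCohomology.ringChange_map]
  exact hz.map_of_isSmoothProjective hY hX f

/-! ### The registered sub-goal -/

/-- **Registered sub-goal `stub_hodgeClassesGenericallyDivisible_at_of_finite_fibre_of_coprime` of
stmt-HodgeConjecture-18466: C1 descends along morphisms of smooth projective `2p`-folds with a
finite fibre of `d` local-homeomorphism points, at every modulus prime to `d`** (closed form; proof:
`hodgeClassesGenericallyDivisible_at_of_finite_fibre_of_coprime`). [cite: Fulton1998, Lemma 19.1.2]
[cite: FultonYoungTableaux1997, Appendix B §B.2 Exercise 5] -/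
theorem stub_hodgeClassesGenericallyDivisible_at_of_finite_fibre_of_coprime :
    ∀ ⦃p : ℕ⦄ ⦃Y X : SchemeOver ℂ⦄ (f : Y ⟶ X), IsSmoothProjective (2 * p) Y →
      IsSmoothProjective (2 * p) X →
      ∀ ⦃ι : Type⦄ [Fintype ι] ⦃v : ι →
      ComplexPoints Y⦄, Function.Injective v →
      ∀ ⦃b : ComplexPoints X⦄, (AlgPoints.map f) ⁻¹' {b} = Set.range v →
      (∀ i, ∃ e : OpenPartialHomeomorph (ComplexPoints Y) (ComplexPoints X), v i ∈ e.source ∧ (e : ComplexPoints Y →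
      ComplexPoints X) = AlgPoints.map f) →
      (∀ w : singularCohomology ℤ ℤ (ComplexPoints Y) (2 * p), IsOfHodgeType (2 * p) Y (2 * p) p p (singularCohomology.ringChange (Int.castRingHom ℂ) (ComplexPoints Y) (2 * p) w) →
      ∀ m : ℕ, 1 ≤ m →
      ∃ Z : Set Y.left, IsClosed Z ∧ Z ≠ Set.univ ∧ ∃ y : singularCohomology ℤ ℤ (complexPointsCompl Y Z) (2 * p), m • y = singularCohomology.map ℤ ℤ (⟨Subtype.val, continuous_subtype_val⟩ : C(complexPointsCompl Y Z, ComplexPoints Y)) (2 * p) w) →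
      ∀ z : singularCohomology ℤ ℤ (ComplexPoints X) (2 * p), IsOfHodgeType (2 * p) X (2 * p) p p (singularCohomology.ringChange (Int.castRingHom ℂ) (ComplexPoints X) (2 * p) z) →
      ∀ m : ℕ, 1 ≤ m →
      (Fintype.card ι).Coprime m →
      ∃ Z : Set X.left, IsClosed Z ∧ Z ≠ Set.univ ∧ ∃ y : singularCohomology ℤ ℤ (complexPointsCompl X Z) (2 * p), m • y = singularCohomology.map ℤ ℤ (⟨Subtype.val, continuous_subtype_val⟩ : C(complexPointsCompl X Z, ComplexPoints X)) (2 * p) z :=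
  fun _ _ _ f hY hX _ _ _ hv _ hfibre hloc hC z hz _ hm hcop ↦
    hodgeClassesGenericallyDivisible_at_of_finite_fibre_of_coprime hY hX f hv hfibre hloc hC z hz hm hcop

end Summit.HodgeConjecture.HodgeConjecture.Theorems

end
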